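import Literature.Claims.NS.Faliush2026
import Literature.Claims.NS.ClayTorusBridge
import Literature.Analysis.FluidPDE.TorusNSGevreySums
import Literature.Analysis.FluidPDE.TorusClassicalNSGalileanBoost
import Literature.Analysis.FluidPDE.TorusWeakStrongUniqueness
import HarnessLib

/-!
# Solo salvage for claim C141 `Faliush2026` (cell `ns-claims`, D-0090): the a priori `H^k` bounds ARE
# Clay (B), and Step 6 (§6 p.4) holds on the Clay data class, kernel

Claim skeleton: `Literature/Claims/NS/Faliush2026.lean` (D. I. Faliush, Zenodo 18406805, 4 pp.; typist
`ns-claims-typist-2` g5, p518896). The skeleton's last link `Step_6 : AprioriHk → ClaimedTheoremT3` (§6 p.4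
«Thus all Leray solutions become smooth and global») is typed for `L²` data and EVERY Leray–Hopf solution and
left unproved there (its docstring: `AprioriHk` is «equivalent in substance to Clay (B) for m = 1»). This
file (seat `ns-claims-salvage-p3` g4) certifies, as for C135 `Siche2026` (`…Theorems.Siche2026Salvage`,
p511368):

* `gradNormSq_eq_hkSq_one` — `‖∇v‖₂² = 4π² · hkSq 1 v` for smooth `v` (spectral enstrophy, tree
  `NSGevrey.hasSum_freqNormSq_mul_norm_sq_mFourierCoeff`);
* `clayB_of_aprioriHk` — `AprioriHk → clayPeriodic.Regularity`: the a priori `H¹` seminorm bound along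
  classical solutions on `[0, T)` excludes the blow-up branch of the tree's maximal classical solution
  (`Torus.exists_maximal_classicalNS_anyMean`, Robinson–Rodrigo–Sadowski 2016 §6.3/§8.1), which is (B) in
  torus form (`clayPeriodic_regularityAt_iff_torus`) — Step 6 is dispensable for Clay (B);
* `step6_smoothData_holds` — Step 6 ON THE CLAY DATA CLASS: for a smooth divergence-free datum, every global
  Leray–Hopf solution agrees a.e. for `t > 0` with a classical solution on `(0, ∞)`, and Leray–Hopf solutions
  from the datum are unique a.e. (Sather–Serrin weak–strong uniqueness, tree
  `Torus.IsGlobalLerayHopf.ae_eq_of_isClassicalNSSolutionOn_Ici`, RRS Thm 6.10).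

The typed `L²` grain of Step 6 (arbitrary `L²` data) needs, beyond this, the `𝕋³` Leray–Hopf restart at an
`H¹` time plus local strong theory from `V`-data and weak–strong uniqueness with a `V`-strong reference — the
same two Literature gaps F1/F2 recorded for C135 `Step8_regularity` (claims/Siche2026/SALVAGE.md); not
attempted here. Nothing in this file bears on the token of the row (predicted `Step_Thm1`, Theorem 1 p.3).

Solo lane (`Theorems/SoloSalvage<Slug>….lean`, no item); records-grade.

WHAT THIS IS NOT: not a claim about NS regularity or blow-up; not a claim about any author beyond the
typed locator.
-/

noncomputable section

set_option linter.dupNamespace false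

open Set MeasureTheory

namespace Summit.NavierStokesRegularity.NavierStokesRegularity.Theorems.Faliush2026Salvage

open Literature.Analysis Literature.Analysis.FluidPDE Literature.Analysis.FunctionSpaces
open Literature.Claims.NS Literature.Claims.NS.Faliush2026 Literature.Claims.NS.ClayVariants

/-- **Spectral enstrophy**: `‖∇v‖₂² = 4π² Σ_k |k|² |v̂(k)|² = 4π² · hkSq 1 v` for a smooth field on `𝕋³`
(Parseval for each `∂ᵢv`; tree `NSGevrey.hasSum_freqNormSq_mul_norm_sq_mFourierCoeff`).
[cite: Grafakos2014, Prop. 3.2.7 (3)] [cite: Faliush2026, §5 p.3 («bounds in all H^k»)] -/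
theorem gradNormSq_eq_hkSq_one {v : T3 → E3} (hv : Torus.IsSmooth v) :
    Torus.gradNormSq v = 4 * Real.pi ^ 2 * hkSq 1 v := by
  have h := NSGevrey.hasSum_freqNormSq_mul_norm_sq_mFourierCoeff hv
  have h' : HasSum (fun k : Z3 => Torus.freqNormSq k ^ 1 * ‖coeff v k‖ ^ 2)
      ((4 * Real.pi ^ 2)⁻¹ * Torus.gradNormSq v) := by
    have h2 := h.mul_left (4 * Real.pi ^ 2)⁻¹
    refine h2.congr_fun fun k => ?_
    simp only [coeff, pow_one]
    field_simp
  rw [hkSq, h'.tsum_eq]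
  field_simp

/-- **The a priori `H^k` bounds give Clay (B)** — Step 6 and the «Leray solutions» sentence of §6 are not
needed for (B): for `ν > 0` and a smooth divergence-free datum on `𝕋³` (any mean) the tree's maximal classical
solution is either global or has unbounded enstrophy on `[0, T*)`; the latter contradicts `AprioriHk` at
`m = 1` (`‖∇u‖₂² = 4π² hkSq 1 u`). [cite: Faliush2026, §5 p.3, §6 p.4] [cite: RobinsonRodrigoSadowskiCUP2016, §6.3 p. 108 and §8.1 p. 122]
[cite: FeffermanClay2006, (B) p. 2] -/
theorem clayB_of_aprioriHk (h : AprioriHk) : clayPeriodic.Regularity := by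
  intro ν hν
  rw [clayPeriodic_regularityAt_iff_torus hν]
  intro U₀ hs hd
  obtain ⟨u, p, hu0, hcases⟩ :=
    Torus.exists_maximal_classicalNS_anyMean (d := Fin 3) (by simp) hν hs hd
  rcases hcases with ⟨hglob, -⟩ | ⟨T, hT, hsol, hnb, -⟩
  · exact ⟨u, p, hglob, hu0⟩
  · obtain ⟨M, hM⟩ := h ν hν T hT u p hsol 1
    refine absurd ⟨4 * Real.pi ^ 2 * M, ?_⟩ hnb
    rintro _ ⟨t, ht, rfl⟩
    show Torus.gradNormSq (u t) ≤ 4 * Real.pi ^ 2 * M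
    rw [gradNormSq_eq_hkSq_one (hsol.smooth_velocity.isSmooth_slice ht)]
    exact mul_le_mul_of_nonneg_left (hM t ht) (by positivity)

/-- **Step 6 on the Clay data class** (§6 p.4 l.1–6 «Thus all Leray solutions become smooth and global»,
read for smooth data): under `AprioriHk`, for every `ν > 0`, every SMOOTH divergence-free datum `u₀` on `𝕋³`
and every global Leray–Hopf weak solution `u` from `u₀`, there is a classical solution `(U, P)` on
`(0, ∞) × 𝕋³` with `U(t) = u(t)` a.e. for all `t > 0`; moreover any two global Leray–Hopf solutions from `u₀`
agree a.e. on every slice `t > 0`. (Global classical solution from `clayB_of_aprioriHk`; identification by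
Sather–Serrin weak–strong uniqueness.) [cite: Faliush2026, §6 p.4 l.1–6] [cite: RobinsonRodrigoSadowskiCUP2016, Thm 6.10] -/
theorem step6_smoothData_holds (h : AprioriHk) :
    ∀ ν : ℝ, 0 < ν → ∀ u₀ : T3 → E3, Torus.IsSmooth u₀ → Torus.IsDivFree u₀ →
      ∀ u : ℝ → T3 → E3, Torus.IsGlobalLerayHopf ν 0 u₀ u →
        (∃ (U : ℝ → T3 → E3) (P : ℝ → T3 → ℝ),
            Torus.IsClassicalNSSolutionOn (Ioi 0) ν 0 U P ∧ ∀ t : ℝ, 0 < t → U t =ᵐ[volume] u t) ∧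
          ∀ u' : ℝ → T3 → E3, Torus.IsGlobalLerayHopf ν 0 u₀ u' →
            ∀ t : ℝ, 0 < t → u' t =ᵐ[volume] u t := by
  intro ν hν u₀ hs hd u hu
  have hreg := clayB_of_aprioriHk h ν hν
  rw [clayPeriodic_regularityAt_iff_torus hν] at hreg
  obtain ⟨U, P, hglob, hU0⟩ := hreg u₀ hs hd
  have hae : ∀ w : ℝ → T3 → E3, Torus.IsGlobalLerayHopf ν 0 u₀ w →
      ∀ t : ℝ, 0 < t → w t =ᵐ[volume] U t := by
    intro w hw
    have hw' : Torus.IsGlobalLerayHopf ν 0 (U 0) w := by rw [hU0]; exact hw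
    exact hw'.ae_eq_of_isClassicalNSSolutionOn_Ici hglob hν.le
  refine ⟨⟨U, P, hglob.mono Ioi_subset_Ici_self (uniqueDiffOn_Ioi 0), fun t ht => (hae u hu t ht).symm⟩, ?_⟩
  intro u' hu' t ht
  exact (hae u' hu' t ht).trans (hae u hu t ht).symm

end Summit.NavierStokesRegularity.NavierStokesRegularity.Theorems.Faliush2026Salvage

end
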